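import Literature.AlgebraicGeometry.Motives.FaltingsECEndAssemblyProofs
import HarnessLib

/-!
# Faltings 1983, Satz 4 for an elliptic curve: the assembly from the core fact alone

Theorem-only `Proofs` companion of `Literature.AlgebraicGeometry.Motives.FaltingsEC`, serving the
named fact `Literature.AlgebraicGeometry.Motives.mem_span_range_tateEndRingHom_iff W ℓ` —
G. Faltings, *Endlichkeitssätze für abelsche Varietäten über Zahlkörpern*, Invent. Math. 73
(1983), 349–366, §5 Satz 4 for `A = E` an elliptic curve over a number field `K` and a prime
`ℓ`: `End_K(E) ⊗_ℤ ℤ_ℓ → End_π(T_ℓ E)`, `π = Gal(K̄/K)`, is an isomorphism (Engl. transl.: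
G. Cornell, J. H. Silverman (eds.), *Arithmetic Geometry*, Springer 1986, Ch. II, §5 Theorem 4;
held copy `book:cornellnd-arithmetic-geometry`, PDF pp. 89–90); in the tree's form: a
`ℤ_ℓ`-linear endomorphism of `T_ℓ E` lies in `ℤ_ℓ · End_K(E)` iff it commutes with `Γ_K`.

## What this file records

`FaltingsECEndAssemblyProofs` keys the fact to two inputs: the finiteness of the `K`-isomorphism
classes in the `K`-isogeny class of `E` (Silverman, *AEC*, Cor. IX.6.2, in any of the forms
Cor. IX.6.2 / Thm. IX.6.1 / Cor. IX.3.2.1) and the residual core fact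
`exists_eq_smul_one_of_equivariant_of_not_hasRationalCM W ℓ` of `FaltingsECEndCore` (for
`End_K(E) = ℤ` and `V_ℓ E` without `Γ_K`-stable `ℚ_ℓ`-line, `End_{Γ_K}(V_ℓ E) = ℚ_ℓ`). The first
input is now a **theorem** of the tree: `WeierstrassCurve.finite_isogenyClass_holds`
(`IsogenyClassFiniteProofs`; Shafarevich's Thm. IX.6.1
`WeierstrassCurve.shafarevich_finite_goodReductionOutside_holds` from Siegel's Cor. IX.3.2.1
`WeierstrassCurve.siegel_finite_integralPoints_holds`, itself from the unit equation after
Beukers–Schlickewei, and Cor. VII.7.2 `WeierstrassCurve.IsIsogenous.badPlaces_eq_holds`).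
Feeding it in leaves Satz 4 for `E` keyed to the core fact **alone**, and turns the conditional
equivalences of `FaltingsECEndAssemblyProofs` into unconditional ones:

* Satz 4 for `E` at `ℓ` **is** the core fact (`mem_span_range_tateEndRingHom_iff_iff_core`), and
  **is** the statement that for `End_K(E) = ℤ` the image of `Γ_K` in `GL(V_ℓ E)` is not abelian
  (`mem_span_range_tateEndRingHom_iff_iff_exists_mul_ne_mul`) — the form in which the residual
  is proved in print: J.-P. Serre, *Abelian ℓ-adic representations and elliptic curves* (1968),
  Ch. IV, §2.2 (for a curve without complex multiplication `Lie ρ_ℓ(Γ_K) = End(V_ℓ E)`; through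
  the local algebraicity of abelian semisimple rational `ℓ`-adic representations, Ch. III), resp.
  Faltings' Sätze 1–2 for the abelian surfaces `(E × E)/G_n`;
* for `End_K(E) = ℤ` the representation `V_ℓ E` is irreducible, unconditionally
  (`finrank_ne_one_of_stable_of_not_hasRationalCM_of_numberField`; Serre 1968, Ch. IV, §2.1,
  "Šafarevič ⇒ irreducible", with complex multiplication read over `K`);
* Satz 4 holds unconditionally for every curve with `K`-rational complex multiplication
  (`mem_span_range_tateEndRingHom_iff_of_hasRationalCM`).

So the discharge `mem_span_range_tateEndRingHom_iff_holds` is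
`mem_span_range_tateEndRingHom_iff_of_core W ℓ (…core…_holds W ℓ)` as soon as the core fact is a
theorem. Status 2026-08-15: the core fact is proved in the tree over number fields with a real
place, for curves with a multiplicative place `v ∤ ℓ`, and for `ord_v(j) < 0` at some `v ∤ 6ℓ`
(`FaltingsECEndCoreCasesProofs`); open for totally imaginary `K` and `j(E)` integral at all
`v ∤ 6ℓ`, where the printed proofs need Tate's Hodge–Tate decomposition (Serre) or Finiteness I
for abelian surfaces (Faltings), neither of which is in Mathlib or the tree.

## Contents (all proved; no definitions, no new named facts)

* `forall_exists_eq_smul_one_iff_exists_mul_ne_mul`: see above.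
* `mem_span_range_tateEndRingHom_iff_of_core`: the core fact ⇒ Satz 4 for `E`.
* `mem_span_range_tateEndRingHom_iff_iff_core`: Satz 4 for `E` ⟺ the core fact.
* `mem_span_range_tateEndRingHom_iff_of_hasRationalCM`: Satz 4 for a curve with `K`-rational CM.
* `finrank_ne_one_of_stable_of_not_hasRationalCM_of_numberField`: `End_K(E) = ℤ` ⇒ `V_ℓ E` has
  no `Γ_K`-stable line.
* `mem_span_range_tateEndRingHom_iff_of_exists_mul_ne_mul`,
  `mem_span_range_tateEndRingHom_iff_iff_exists_mul_ne_mul`: Satz 4 for `E` ⟺ non-abelian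
  `ℓ`-adic image of the curves with `End_K(E) = ℤ`.
* `forall_exists_eq_smul_one_iff_exists_mul_ne_mul` (linear algebra in a plane: scalar
  commutant ⟺ non-commutative family) and `exists_eq_smul_one_of_equivariant_iff_exists_mul_ne_mul`:
  for `E` elliptic over any field `K` and `ℓ ≠ char K`, `End_{Γ_K}(V_ℓ E) = ℚ_ℓ` ⟺ the image of
  `Γ_K` in `GL(V_ℓ E)` is not abelian.
* `mem_span_range_tateModule_map_of_equivariant_self_of_core`: Faltings' Korollar 1 for the pair
  `(E, E)` from the core fact.

## References

* [Faltings1983Endlichkeit] G. Faltings, Invent. Math. 73 (1983), 349–366, §5 Satz 4 and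
  Korollar 1, with the proof of Sätze 3–4; Engl. transl. in Cornell–Silverman (eds.),
  *Arithmetic Geometry* (1986), Ch. II §5, Theorems 3–4, Corollary 1 (held copy
  `book:cornellnd-arithmetic-geometry`, PDF pp. 89–90; read).
* [Serre1968] J.-P. Serre, *Abelian ℓ-adic representations and elliptic curves*, Benjamin 1968,
  Ch. IV, §2.1 and §2.2; not held, cited from the standard account.
* [SilvermanAEC2009] J. H. Silverman, *The Arithmetic of Elliptic Curves*, 2nd ed., GTM 106:
  Cor. IX.3.2.1, Thm. IX.6.1, Cor. IX.6.2.

## Design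

Theorems only; `noncomputable section`; one universe `u`; base field `K : Type u` with the
instance hypotheses `[NumberField K] [W.IsElliptic]` quantified inside the named facts, as in
`FaltingsEC`; names as in `FaltingsECEndAssemblyProofs` with the suffix `_of_isogenyClass`
dropped. The file imports `FaltingsECEndAssemblyProofs` only (which reaches
`IsogenyClassFiniteProofs` and `FaltingsECEndCoreProofs`).
-/

noncomputable section

universe u

namespace Literature.AlgebraicGeometry.Motives

open WeierstrassCurve Module

/-! ## Linear algebra: scalar commutant ⟺ non-commutative family, in a plane -/

section TwoDim

variable {F V G : Type*} [Field F] [AddCommGroup V] [Module F V]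

/-- **In a plane, a family of endomorphisms has scalar commutant iff it is not commutative.**
Let `V` be two-dimensional over a field `F` and `ρ : G → End(V)` any family. Every endomorphism
commuting with all `ρ g` is a scalar if and only if some `ρ g, ρ g'` do not commute. (⇐) a
non-scalar `s` in the commutant puts every `ρ g` in `F + F s`
(`commute_of_forall_commute_of_not_exists_eq_smul_one`), so the `ρ g` commute; (⇒) if the `ρ g`
commute pairwise, then either some `ρ g₀` is not a scalar — and lies in the commutant — or all
`ρ g` are scalars — and the commutant is `End(V)`, which contains a non-scalar element
(`exists_ne_smul_one_of_finrank_eq_two`). [folklore] -/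
theorem forall_exists_eq_smul_one_iff_exists_mul_ne_mul (h2 : finrank F V = 2)
    (ρ : G → Module.End F V) :
    (∀ s : Module.End F V, (∀ g, s * ρ g = ρ g * s) → ∃ c : F, s = c • 1) ↔
      ∃ g g' : G, ρ g * ρ g' ≠ ρ g' * ρ g := by
  constructor
  · intro hsc
    by_contra hab
    push Not at hab
    by_cases hall : ∀ g : G, ∃ c : F, ρ g = c • 1
    · -- every `ρ g` is a scalar: a non-scalar endomorphism lies in the commutant
      obtain ⟨s, hs⟩ := exists_ne_smul_one_of_finrank_eq_two h2
      refine hs (hsc s fun g ↦ ?_)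
      obtain ⟨c, hc⟩ := hall g
      rw [hc, Algebra.mul_smul_comm, Algebra.smul_mul_assoc, mul_one, one_mul]
    · -- some `ρ g₀` is not a scalar, and it lies in the commutant since the family commutes
      push Not at hall
      obtain ⟨g₀, hg₀⟩ := hall
      obtain ⟨c, hc⟩ := hsc (ρ g₀) fun g ↦ hab g₀ g
      exact hg₀ c hc
  · rintro ⟨g, g', hgg'⟩ s hs
    by_contra hns
    exact hgg' (commute_of_forall_commute_of_not_exists_eq_smul_one h2 ρ hs hns g g')

end TwoDim

variable {K : Type u} [Field K] (W : WeierstrassCurve K) (ℓ : ℕ) [Fact ℓ.Prime]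

/-! ## Satz 4 for `E` from the core fact alone -/

/-- **Satz 4 for `E` from the core fact.** For a Weierstrass curve `W` over a field `K` and a
prime `ℓ`, the named fact `mem_span_range_tateEndRingHom_iff W ℓ` (Faltings 1983, §5 Satz 4 for
`A = E`: for `K` a number field and `E` elliptic, `End_K(E) ⊗ ℤ_ℓ ≅ End_{Γ_K}(T_ℓ E)`) follows
from `exists_eq_smul_one_of_equivariant_of_not_hasRationalCM W ℓ` alone: the tree's
`mem_span_range_tateEndRingHom_iff_of_isogenyClass_of_core` with *AEC* Cor. IX.6.2 supplied by
the theorem `WeierstrassCurve.finite_isogenyClass_holds`.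
[cite: Faltings1983Endlichkeit, §5 Satz 4 (proof, transl. PDF pp. 89–90)] -/
theorem mem_span_range_tateEndRingHom_iff_of_core
    (hcore : exists_eq_smul_one_of_equivariant_of_not_hasRationalCM W ℓ) :
    mem_span_range_tateEndRingHom_iff W ℓ :=
  mem_span_range_tateEndRingHom_iff_of_isogenyClass_of_core W ℓ (finite_isogenyClass_holds W) hcore

/-- **Satz 4 for `E` is exactly the core fact.** For a Weierstrass curve `W` over a field `K`
and a prime `ℓ`: `mem_span_range_tateEndRingHom_iff W ℓ` ⟺
`exists_eq_smul_one_of_equivariant_of_not_hasRationalCM W ℓ` (forward: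
`exists_eq_smul_one_of_equivariant_of_not_hasRationalCM_of_faltings`; backward:
`mem_span_range_tateEndRingHom_iff_of_core`). [cite: Faltings1983Endlichkeit, §5 Satz 4] -/
theorem mem_span_range_tateEndRingHom_iff_iff_core :
    mem_span_range_tateEndRingHom_iff W ℓ ↔
      exists_eq_smul_one_of_equivariant_of_not_hasRationalCM W ℓ :=
  mem_span_range_tateEndRingHom_iff_iff_core_of_isogenyClass W ℓ (finite_isogenyClass_holds W)

/-- **Satz 4 for a curve with `K`-rational complex multiplication** (unconditional). For a
Weierstrass curve `W` over a field `K` with `W.HasRationalCM` and a prime `ℓ`, the named fact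
`mem_span_range_tateEndRingHom_iff W ℓ` holds: the core fact is vacuous and *AEC* Cor. IX.6.2
is the theorem `WeierstrassCurve.finite_isogenyClass_holds`.
[cite: Faltings1983Endlichkeit, §5 Satz 4 (case of K-rational complex multiplication)] -/
theorem mem_span_range_tateEndRingHom_iff_of_hasRationalCM (hCM : W.HasRationalCM) :
    mem_span_range_tateEndRingHom_iff W ℓ :=
  mem_span_range_tateEndRingHom_iff_of_hasRationalCM_of_isogenyClass W ℓ hCM
    (finite_isogenyClass_holds W)

/-! ## Irreducibility of `V_ℓ E` for `End_K(E) = ℤ` (Serre 1968, IV.2.1), unconditionally -/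

/-- **For `End_K(E) = ℤ` the representation `V_ℓ E` is irreducible.** For an elliptic curve
`E = W` over a number field `K` with no `K`-rational complex multiplication and a prime `ℓ`,
no `ℚ_ℓ`-line of `V_ℓ E` is `Γ_K`-stable: the tree's
`finrank_ne_one_of_stable_of_not_hasRationalCM_of_isogenyClass` (a stable line is `a(V_ℓ E)` for
some `a ∈ E_ℓ = ℚ_ℓ` by line realization, Tate's argument on the quotients `E/G_n`) with *AEC*
Cor. IX.6.2 supplied by `WeierstrassCurve.finite_isogenyClass_holds`. This is Serre, *Abelian
ℓ-adic representations* (1968), Ch. IV, §2.1 ("Šafarevič's theorem ⇒ `V_ℓ` irreducible"), with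
complex multiplication read over `K`. [cite: Serre1968, Ch. IV §2.1]
[cite: SilvermanAEC2009, Cor. IX.6.2] -/
theorem finrank_ne_one_of_stable_of_not_hasRationalCM_of_numberField [NumberField K]
    [W.IsElliptic] (hCM : ¬ W.HasRationalCM) (L : Submodule ℚ_[ℓ] (W.rationalTateModule ℓ))
    (hL : ∀ σ : Field.absoluteGaloisGroup K, ∀ v ∈ L, rationalGaloisRepTate W ℓ σ v ∈ L) :
    finrank ℚ_[ℓ] L ≠ 1 :=
  finrank_ne_one_of_stable_of_not_hasRationalCM_of_isogenyClass W ℓ (finite_isogenyClass_holds W)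
    hCM L hL

/-! ## Satz 4 for `E` as the non-abelianness of the `ℓ`-adic image, unconditionally -/

/-- **Satz 4 for `E` from a non-abelian `ℓ`-adic image.** If, whenever `E = W` is elliptic over
a number field `K` with `End_K(E) = ℤ`, some `ρ(σ), ρ(τ)` do not commute on `V_ℓ E` (Serre 1968,
Ch. IV, §2.2 for curves without complex multiplication), then
`mem_span_range_tateEndRingHom_iff W ℓ`. [cite: Faltings1983Endlichkeit, §5 Satz 4 (proof)] -/
theorem mem_span_range_tateEndRingHom_iff_of_exists_mul_ne_mul
    (h : ∀ [NumberField K] [W.IsElliptic], ¬ W.HasRationalCM →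
      ∃ σ τ : Field.absoluteGaloisGroup K,
        rationalGaloisRepTate W ℓ σ * rationalGaloisRepTate W ℓ τ ≠
          rationalGaloisRepTate W ℓ τ * rationalGaloisRepTate W ℓ σ) :
    mem_span_range_tateEndRingHom_iff W ℓ :=
  mem_span_range_tateEndRingHom_iff_of_isogenyClass_of_exists_mul_ne_mul W ℓ
    (finite_isogenyClass_holds W) h

/-- **Satz 4 for `E` is the non-abelianness of the `ℓ`-adic image of the curves with
`End_K(E) = ℤ`.** For a Weierstrass curve `W` over a field `K` and a prime `ℓ`,
`mem_span_range_tateEndRingHom_iff W ℓ` (Faltings' Satz 4 for `E`) holds iff: whenever `K` is a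
number field, `E = W` is elliptic and `E` has no `K`-rational complex multiplication, there are
`σ, τ ∈ Γ_K` with `ρ(σ) ρ(τ) ≠ ρ(τ) ρ(σ)` on `V_ℓ E` (forward `exists_mul_ne_mul_of_faltings`,
backward `mem_span_range_tateEndRingHom_iff_of_exists_mul_ne_mul`).
[cite: Faltings1983Endlichkeit, §5 Satz 4] [cite: Serre1968, Ch. IV §2.2] -/
theorem mem_span_range_tateEndRingHom_iff_iff_exists_mul_ne_mul :
    mem_span_range_tateEndRingHom_iff W ℓ ↔
      ∀ [NumberField K] [W.IsElliptic], ¬ W.HasRationalCM →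
        ∃ σ τ : Field.absoluteGaloisGroup K,
          rationalGaloisRepTate W ℓ σ * rationalGaloisRepTate W ℓ τ ≠
            rationalGaloisRepTate W ℓ τ * rationalGaloisRepTate W ℓ σ :=
  mem_span_range_tateEndRingHom_iff_iff_exists_mul_ne_mul_of_isogenyClass W ℓ
    (finite_isogenyClass_holds W)

/-- **`End_{Γ_K}(V_ℓ E) = ℚ_ℓ` iff the image of `Γ_K` is not abelian** (any base field). For
an elliptic curve `E = W` over a field `K` and a prime `ℓ ≠ char K`, every `Γ_K`-equivariant
`ℚ_ℓ`-linear endomorphism of `V_ℓ E` is a scalar if and only if some `ρ(σ), ρ(τ)` do not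
commute on `V_ℓ E`: `forall_exists_eq_smul_one_iff_exists_mul_ne_mul` on the plane `V_ℓ E`
(`WeierstrassCurve.finrank_rationalTateModule_eq_two_holds`). In particular the core fact of
Satz 4 for `E` at `ℓ` says precisely that `ρ_ℓ(Γ_K)` is not abelian when `End_K(E) = ℤ`
(Serre 1968, Ch. IV, §2.2 for curves without complex multiplication). [folklore] -/
theorem exists_eq_smul_one_of_equivariant_iff_exists_mul_ne_mul [W.IsElliptic]
    (hℓK : (ℓ : K) ≠ 0) :
    (∀ G : Module.End ℚ_[ℓ] (W.rationalTateModule ℓ),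
      (∀ (σ : Field.absoluteGaloisGroup K) (v : W.rationalTateModule ℓ),
        G (rationalGaloisRepTate W ℓ σ v) = rationalGaloisRepTate W ℓ σ (G v)) →
      ∃ c : ℚ_[ℓ], G = c • 1) ↔
    ∃ σ τ : Field.absoluteGaloisGroup K,
      rationalGaloisRepTate W ℓ σ * rationalGaloisRepTate W ℓ τ ≠
        rationalGaloisRepTate W ℓ τ * rationalGaloisRepTate W ℓ σ := by
  rw [← forall_exists_eq_smul_one_iff_exists_mul_ne_mul
    (finrank_rationalTateModule_eq_two_holds W ℓ hℓK) fun σ ↦ rationalGaloisRepTate W ℓ σ]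
  exact forall_congr' fun G ↦ imp_congr_left
    ⟨fun hG σ ↦ LinearMap.ext fun v ↦ hG σ v, fun hG σ v ↦ LinearMap.congr_fun (hG σ) v⟩

/-! ## Faltings' Korollar 1 for `(E, E)` from the core fact alone -/

/-- **Faltings' Korollar 1 for the pair `(E, E)` from the core fact.** The named fact
`mem_span_range_tateModule_map_of_equivariant W W ℓ` (every `Γ_K`-equivariant `ℤ_ℓ`-linear
`T_ℓ E → T_ℓ E` is a `ℤ_ℓ`-combination of the `T_ℓ φ`, `φ : E → E` an isogeny over `K`) follows
from `exists_eq_smul_one_of_equivariant_of_not_hasRationalCM W ℓ` alone: the tree's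
`mem_span_range_tateModule_map_of_equivariant_self_of_isogenyClass_of_core` with *AEC*
Cor. IX.6.2 supplied by `WeierstrassCurve.finite_isogenyClass_holds`.
[cite: Faltings1983Endlichkeit, §5 Satz 4, Korollar 1] -/
theorem mem_span_range_tateModule_map_of_equivariant_self_of_core
    (hcore : exists_eq_smul_one_of_equivariant_of_not_hasRationalCM W ℓ) :
    mem_span_range_tateModule_map_of_equivariant W W ℓ := by
  -- tactic form: a term-mode proof trips the `overlappingInstances` linter on the two
  -- `[W.IsElliptic]` binders of the unfolded fact for the pair `(W, W)`
  intro _ _ _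
  exact mem_span_range_tateModule_map_of_equivariant_self_of_isogenyClass_of_core W ℓ
    (finite_isogenyClass_holds W) hcore

end Literature.AlgebraicGeometry.Motives

end
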